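import Summits.CriticalPhenomena.PercolationContinuityZ3.Theses.PercBudgetLadder
import Literature.Probability.Percolation.SharpnessDCTProofs
import Literature.Probability.Percolation.LatticeSymmetry

/-!
# `DefectDimensionOfQuantBGN` (route `PercBudgetLadder`, item `stmt-CriticalPhenomena-5252`)

A polynomial rate in the Barsky–Grimmett–Newman theorem,
`P_{p_c}(0 ↔ {‖y‖∞ ≥ r} inside the half-space {x₀ ≥ 0}) ≤ C r^{-a}` (`r ≥ 1`), implies defect
dimension `< 2` for the critical annulus `B(n) → ∂B(2n)` of `ℤ³` with saving `c = a/2`: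
`P_{p_c}(MinCut(n,2n) ≤ n^{2-a/2}) → 1`.

Proof (Rossignol–Théret 2018, Prop. 3.9, Bernoulli case, run on the WHOLE annulus instead of the
six face slabs; Zhang 2000). Fix `n ≥ 2`, `k = 2n - 1`. For a lattice configuration `ω` let
`W(ω)` be the set of vertices of `B(k)` joined to `B(n)` by an open path inside `B(k)`, and let
`S(ω)` be the set of ALL lattice edges at the vertices `u ∈ ∂B(k) ∩ W(ω)`. Every open path inside
`B(2n)` from `B(n) ⊆ W(ω)` to `∂B(2n)` (disjoint from `B(k)`) has a first edge `{u, v}` leaving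
`W(ω)`; as `v ∉ W(ω)` although `{u, v}` is open, `v ∉ B(k)`, so `u ∈ ∂B(k) ∩ W(ω)` and
`{u, v} ∈ S(ω)`: closing `S(ω)` blocks the annulus, and `#S(ω) ≤ 6 N(ω)`,
`N(ω) = #(∂B(k) ∩ W(ω))` (`exists_cutset_card_le`). For `u ∈ ∂B(k)`, say `|u_i| = k`, the
lattice symmetry `z ↦ σ(z - u)` (`σ` the signed permutation exchanging the axes `i` and `0`, with
the sign making `B(k) - u` land in `{x₀ ≥ 0}`) carries `{u ↔ B(n) inside B(k)}` into the
half-space arm event of the hypothesis with `r = k - n = n - 1` (`real_arm_le`), so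
`E N ≤ #∂B(k) · C (n-1)^{-a} ≤ 6(4n-1)² C (n-1)^{-a}`. Markov's inequality for the sum of
indicators `N` at level `n^{2-a/2}/6` (`measureReal_setOf_le_sum_indicator_le`) gives
`P(MinCut(n,2n) > n^{2-a/2}) ≤ 576 · 2^a · C · n^{-a/2} → 0`.

Tools: `DCT16.real_mono_of_forall_subset_edgeSet` (`P_p`-a.s. `ω ⊆ E(ℤ³)`),
`DCT16.measurableSet_openConnIn`, `card_innerBoundary_box_le`, `zdSignedPermIso`, `zdShiftIso`,
`bondPercolation_real_preimage_relabel_iso`, `relabel_mem_openConnIn`,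
`SimpleGraph.Walk.exists_boundary_dart`, `MeasureTheory.mul_meas_ge_le_integral_of_nonneg`.

References: R. Rossignol, M. Théret, EJP 23 (2018), Prop. 3.9 [RossignolTheret2018];
Y. Zhang, J. Stat. Phys. 98 (2000) [Zhang2000]; D. Barsky, G. Grimmett, C. Newman, PTRF 90 (1991)
[BarskyGrimmettNewman1991].
-/

namespace Summit.CriticalPhenomena.PercolationContinuityZ3.Theorems

open MeasureTheory ProbabilityTheory Filter
open Literature.Probability.Percolation Literature.Probability.LatticeModels
open scoped Topology

noncomputable section

/-! ### Markov's inequality for a sum of indicators -/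

/-- **First-moment bound for a counting variable.** For events `E u`, `u ∈ U` (finite), and a
level `k > 0`: `μ{ω | k ≤ #{u ∈ U : ω ∈ E u}} ≤ (∑_{u ∈ U} μ(E u)) / k` (Markov's inequality
applied to the sum of the indicators). [folklore] -/
theorem measureReal_setOf_le_sum_indicator_le {Ω ι : Type*} [MeasurableSpace Ω] (μ : Measure Ω)
    [IsFiniteMeasure μ] (U : Finset ι) (E : ι → Set Ω) (hE : ∀ u ∈ U, MeasurableSet (E u))
    {k : ℝ} (hk : 0 < k) :
    μ.real {ω | k ≤ ∑ u ∈ U, (E u).indicator (1 : Ω → ℝ) ω} ≤ (∑ u ∈ U, μ.real (E u)) / k := by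
  have hint : ∀ u ∈ U, Integrable ((E u).indicator (1 : Ω → ℝ)) μ :=
    fun u hu => (integrable_const (1 : ℝ)).indicator (hE u hu)
  have hsum : Integrable (fun ω => ∑ u ∈ U, (E u).indicator (1 : Ω → ℝ) ω) μ :=
    integrable_finsetSum U hint
  have hnn : 0 ≤ᵐ[μ] fun ω => ∑ u ∈ U, (E u).indicator (1 : Ω → ℝ) ω :=
    Eventually.of_forall fun ω => Finset.sum_nonneg fun u _ =>
      Set.indicator_nonneg (fun _ _ => zero_le_one) _
  have hI : ∫ ω, (∑ u ∈ U, (E u).indicator (1 : Ω → ℝ) ω) ∂μ = ∑ u ∈ U, μ.real (E u) := by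
    rw [integral_finsetSum U hint]
    exact Finset.sum_congr rfl fun u hu => integral_indicator_one (hE u hu)
  rw [le_div_iff₀ hk, mul_comm, ← hI]
  exact mul_meas_ge_le_integral_of_nonneg hnn hsum k

/-! ### The random cutset of the annulus -/

/-- The arm events `{u ↔ B(n) inside B(k)} = ⋃_{x ∈ B(n)} {u ↔ x in B(k)}` are measurable
(finite unions of local events). [folklore] -/
theorem measurableSet_iUnion_openConnIn_box (n k : ℕ) (u : Site 3) :
    MeasurableSet (⋃ x ∈ box 3 n, openConnIn (↑(box 3 k) : Set (Site 3)) u x) :=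
  Finset.measurableSet_biUnion (box 3 n) fun x _ => DCT16.measurableSet_openConnIn (box 3 k) u x

/-- **The Rossignol–Théret cutset of the annulus, whole-annulus form.** Let `n ≤ k` and let `ω`
be a lattice configuration of `ℤ³`. Then there is a finite set `S` of edges, with
`#S ≤ 6 · #{u ∈ ∂B(k) : u ↔ B(n) inside B(k)}`, whose closing leaves no open path inside
`B(k+1)` from `B(n)` to `∂B(k+1)`: take all lattice edges at the vertices of `∂B(k)` joined to
`B(n)` inside `B(k)`; an open crossing has a first edge `{u, v}` leaving the set `W` of vertices of
`B(k)` joined to `B(n)` inside `B(k)`, and since `{u, v}` is open, `v ∉ B(k)`, whence `u ∈ ∂B(k)`.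
(Rossignol–Théret 2018, proof of Prop. 3.9: the cutset `Δ W` and its open edges.)
[cite: RossignolTheret2018, Prop. 3.9] -/
theorem exists_cutset_card_le {n k : ℕ} (hnk : n ≤ k) {ω : BondConfig (Site 3)}
    (hω : ω ⊆ (zdGraph 3).edgeSet) :
    ∃ S : Finset (Sym2 (Site 3)),
      (S.card : ℝ) ≤ 6 * ∑ u ∈ innerBoundary (zdGraph 3) (box 3 k),
          (⋃ x ∈ box 3 n, openConnIn (↑(box 3 k) : Set (Site 3)) u x).indicator
            (1 : BondConfig (Site 3) → ℝ) ω ∧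
      ¬ ∃ x ∈ box 3 n, ∃ y ∈ innerBoundary (zdGraph 3) (box 3 (k + 1)),
        (ω \ ↑S) ∈ openConnIn (↑(box 3 (k + 1)) : Set (Site 3)) x y := by
  classical
  set arm : Site 3 → Set (BondConfig (Site 3)) :=
    fun u => ⋃ x ∈ box 3 n, openConnIn (↑(box 3 k) : Set (Site 3)) u x with harm
  set W' : Finset (Site 3) := (innerBoundary (zdGraph 3) (box 3 k)).filter fun u => ω ∈ arm u
    with hW'
  set S : Finset (Sym2 (Site 3)) :=
    W'.biUnion fun u => ((zdGraph 3).neighborFinset u).image fun v => s(u, v) with hS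
  refine ⟨S, ?_, ?_⟩
  · -- the cardinality bound `#S ≤ 6 #W'`
    have h1 : S.card ≤ ∑ u ∈ W', (((zdGraph 3).neighborFinset u).image fun v => s(u, v)).card :=
      Finset.card_biUnion_le
    have h2 : ∀ u, (((zdGraph 3).neighborFinset u).image fun v => s(u, v)).card ≤ 6 := by
      intro u
      refine Finset.card_image_le.trans ?_
      rw [card_neighborFinset_zdGraph_holds u]
    have h3 : S.card ≤ 6 * W'.card := by
      calc S.card ≤ ∑ _u ∈ W', 6 := h1.trans (Finset.sum_le_sum fun u _ => h2 u)
        _ = 6 * W'.card := by rw [Finset.sum_const, smul_eq_mul, mul_comm]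
    have h4 : (W'.card : ℝ) = ∑ u ∈ innerBoundary (zdGraph 3) (box 3 k), (arm u).indicator 1 ω := by
      rw [hW', Finset.natCast_card_filter]
      refine Finset.sum_congr rfl fun u _ => ?_
      rw [Set.indicator_apply, Pi.one_apply]
    calc (S.card : ℝ) ≤ ((6 * W'.card : ℕ) : ℝ) := by exact_mod_cast h3
      _ = 6 * ∑ u ∈ innerBoundary (zdGraph 3) (box 3 k), (arm u).indicator 1 ω := by
        rw [Nat.cast_mul, h4]; norm_num
  · -- the cutset property
    rintro ⟨x, hx, y, hy, hxR, hyR, ⟨p⟩⟩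
    let Wset : Set (↥(↑(box 3 (k + 1)) : Set (Site 3))) :=
      {z | (z : Site 3) ∈ box 3 k ∧ ω ∈ arm z}
    have hxk : x ∈ box 3 k := box_mono 3 hnk hx
    have hxW : (⟨x, hxR⟩ : ↥(↑(box 3 (k + 1)) : Set (Site 3))) ∈ Wset := by
      refine ⟨hxk, ?_⟩
      simp only [harm, Set.mem_iUnion]
      exact ⟨x, hx, Finset.mem_coe.2 hxk, Finset.mem_coe.2 hxk, SimpleGraph.Reachable.refl _⟩
    have hyW : (⟨y, hyR⟩ : ↥(↑(box 3 (k + 1)) : Set (Site 3))) ∉ Wset := fun h =>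
      DCT16.notMem_box_of_mem_innerBoundary_box (Nat.lt_succ_self k) hy h.1
    obtain ⟨d, -, hd1, hd2⟩ := p.exists_boundary_dart Wset hxW hyW
    have hadj := d.adj
    rw [SimpleGraph.induce_adj, openGraph_adj] at hadj
    obtain ⟨⟨hωuv, hSuv⟩, hne⟩ := hadj
    obtain ⟨huk, huarm⟩ := hd1
    -- `v ∉ B(k)`: otherwise `v ∈ W` through the open edge `{u, v}`
    have hvk : (d.snd : Site 3) ∉ box 3 k := by
      intro hvk
      apply hd2
      refine ⟨hvk, ?_⟩
      simp only [harm, Set.mem_iUnion] at huarm ⊢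
      obtain ⟨x', hx', hux'⟩ := huarm
      obtain ⟨huS, hx'S, hr⟩ := hux'
      refine ⟨x', hx', Finset.mem_coe.2 hvk, hx'S, SimpleGraph.Reachable.trans ?_ hr⟩
      refine SimpleGraph.Adj.reachable ?_
      rw [SimpleGraph.induce_adj, openGraph_adj]
      exact ⟨by rw [Sym2.eq_swap]; exact hωuv,
        fun h => hne (congrArg Subtype.val (Subtype.ext h)).symm⟩
    have hadjG : (zdGraph 3).Adj (d.fst : Site 3) (d.snd : Site 3) :=
      (SimpleGraph.mem_edgeSet _).1 (hω hωuv)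
    have hub : (d.fst : Site 3) ∈ innerBoundary (zdGraph 3) (box 3 k) :=
      mem_innerBoundary_iff.2 ⟨huk, _, hvk, hadjG⟩
    apply hSuv
    rw [Finset.mem_coe]
    show _ ∈ W'.biUnion fun u => ((zdGraph 3).neighborFinset u).image fun v => s(u, v)
    rw [Finset.mem_biUnion]
    refine ⟨d.fst, Finset.mem_filter.2 ⟨hub, huarm⟩, Finset.mem_image.2 ⟨d.snd, ?_, rfl⟩⟩
    exact (SimpleGraph.mem_neighborFinset _ _ _).2 hadjG

/-! ### The half-space arm bound by a lattice symmetry -/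

/-- `{x ↔ y in S}` is monotone in the region `S` (local copy of the folklore lemma
`openConnIn_mono` of `RSW.lean`, not imported here). [folklore] -/
theorem openConnIn_mono_region {S S' : Set (Site 3)} (h : S ⊆ S') (x y : Site 3) :
    (openConnIn S x y : Set (BondConfig (Site 3))) ⊆ openConnIn S' x y := by
  rintro ω ⟨hx, hy, hr⟩
  exact ⟨h hx, h hy, hr.map (SimpleGraph.induceHomOfLE (G := openGraph ω) h).toHom⟩

/-- **The arm of a boundary vertex is a half-space arm.** For `u ∈ ∂B(k)` (say `|u_i| = k`) and
`r ≤ k - n`, the event `{u ↔ B(n) inside B(k)}` has `P_p`-probability at most that of the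
half-space arm event `{∃ y, ‖y‖∞ ≥ r, 0 ↔ y inside {x₀ ≥ 0}}`: the lattice symmetry
`z ↦ σ(z - u)`, `σ` the signed coordinate permutation exchanging the axes `i` and `0` with the sign
for which `σ(B(k) - u) ⊆ {x₀ ≥ 0}`, is an automorphism of `ℤ³` preserving `P_p`
(`bondPercolation_real_preimage_relabel_iso`), maps `u` to `0`, open paths inside `B(k)` to open
paths inside the half-space, and every `x ∈ B(n)` to a point with `|x₀| ≥ k - n`.
(Rossignol–Théret 2018, proof of Prop. 3.9, "by symmetry"; Grimmett 1999, §1.6.)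
[cite: RossignolTheret2018, Prop. 3.9] -/
theorem real_arm_le {n k : ℕ} {r : ℤ} (hr : r ≤ (k : ℤ) - n) {u : Site 3}
    (hu : u ∈ innerBoundary (zdGraph 3) (box 3 k)) (p : unitInterval) :
    (bondPercolation (zdGraph 3) p).real
        (⋃ x ∈ box 3 n, openConnIn (↑(box 3 k) : Set (Site 3)) u x) ≤
      (bondPercolation (zdGraph 3) p).real
        {ω | ∃ y : Site 3, (∃ i : Fin 3, r ≤ |y i|) ∧
          ω ∈ openConnIn {x : Site 3 | 0 ≤ x 0} 0 y} := by
  obtain ⟨i, hi⟩ := exists_eq_of_mem_innerBoundary_box hu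
  -- a sign `σ` with `σ * u i = -k`
  obtain ⟨σ, hσ, hσu⟩ : ∃ σ : ℤˣ, ((σ : ℤ) = 1 ∨ (σ : ℤ) = -1) ∧ (σ : ℤ) * u i = -(k : ℤ) := by
    rcases hi with h | h
    · exact ⟨-1, Or.inr (by simp), by rw [h]; simp⟩
    · exact ⟨1, Or.inl (by simp), by rw [h]; simp⟩
  let ε : Fin 3 → ℤˣ := Function.update 1 0 σ
  let π : Equiv.Perm (Fin 3) := Equiv.swap i 0
  let φ : zdGraph 3 ≃g zdGraph 3 := (zdSignedPermIso π ε).comp (zdShiftIso (-u))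
  have hφ : ∀ z : Site 3, φ.toEquiv z = Site.signedPerm π ε (z + -u) := fun z => rfl
  have hφ0 : ∀ z : Site 3, φ.toEquiv z 0 = (σ : ℤ) * z i + k := by
    intro z
    rw [hφ, Site.signedPerm_apply]
    have h1 : π.symm 0 = i := by simp [π, Equiv.symm_swap]
    have h2 : ε 0 = σ := by simp [ε]
    rw [h1, h2, Pi.add_apply, Pi.neg_apply, mul_add, mul_neg, hσu]
    ring
  have hφu : φ.toEquiv u = 0 := by
    rw [hφ, add_neg_cancel, Site.signedPerm_zero]
  -- the image of `B(k)` lies in the half-space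
  have hH : φ.toEquiv '' (↑(box 3 k) : Set (Site 3)) ⊆ {x : Site 3 | 0 ≤ x 0} := by
    rintro _ ⟨z, hz, rfl⟩
    rw [Set.mem_setOf_eq, hφ0]
    have := (mem_box.1 (Finset.mem_coe.1 hz)) i
    rcases hσ with h | h <;> rw [h] <;> omega
  -- the points of `B(n)` are displaced by at least `k - n` in the coordinate `0`
  have hfar : ∀ x ∈ box 3 n, r ≤ |φ.toEquiv x 0| := by
    intro x hx
    rw [hφ0]
    have := (mem_box.1 hx) i
    refine le_trans ?_ (le_abs_self _)
    rcases hσ with h | h <;> rw [h] <;> omega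
  -- event inclusion
  have hsub : (⋃ x ∈ box 3 n, openConnIn (↑(box 3 k) : Set (Site 3)) u x) ⊆
      BondConfig.relabel (sym2Equiv φ.toEquiv) ⁻¹'
        {ω | ∃ y : Site 3, (∃ i : Fin 3, r ≤ |y i|) ∧
          ω ∈ openConnIn {x : Site 3 | 0 ≤ x 0} 0 y} := by
    intro ω hω
    simp only [Set.mem_iUnion] at hω
    obtain ⟨x, hx, hωx⟩ := hω
    refine ⟨φ.toEquiv x, ⟨0, hfar x hx⟩, ?_⟩
    have h := relabel_mem_openConnIn φ.toEquiv hωx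
    rw [hφu] at h
    exact openConnIn_mono_region hH _ _ h
  calc (bondPercolation (zdGraph 3) p).real
        (⋃ x ∈ box 3 n, openConnIn (↑(box 3 k) : Set (Site 3)) u x)
      ≤ (bondPercolation (zdGraph 3) p).real (BondConfig.relabel (sym2Equiv φ.toEquiv) ⁻¹'
          {ω | ∃ y : Site 3, (∃ i : Fin 3, r ≤ |y i|) ∧
            ω ∈ openConnIn {x : Site 3 | 0 ≤ x 0} 0 y}) := measureReal_mono hsub
    _ = _ := bondPercolation_real_preimage_relabel_iso φ p _

/-! ### The first-moment estimate and the limit -/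

/-- **The main estimate.** Under the quantitative BGN hypothesis with constants `a > 0`, `C ≥ 0`,
for every `m` (annulus `B(m+2) → ∂B(2m+4)`, middle sphere `∂B(2m+3)`, arm length `m + 1`):
`P_{p_c}(MinCut ≤ (m+2)^{2-a/2}) ≥ 1 - 576 · 2^a · C · (m+2)^{-a/2}` — the random cutset
(`exists_cutset_card_le`), Markov (`measureReal_setOf_le_sum_indicator_le`), the half-space arm
bound (`real_arm_le`) and `#∂B(2m+3) ≤ 6(4m+7)² ≤ 96(m+2)²` (`card_innerBoundary_box_le`).
(Rossignol–Théret 2018, Prop. 3.9 with a rate; Zhang 2000.)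
[cite: RossignolTheret2018, Prop. 3.9] -/
theorem real_budgetEvent_ge {a C : ℝ} (ha : 0 < a) (hC : 0 ≤ C)
    (hH : ∀ r : ℕ, 1 ≤ r → (bondPercolation (zdGraph 3) (criticalProbI 3)).real
      {ω | ∃ y : Site 3, (∃ i : Fin 3, (r : ℤ) ≤ |y i|) ∧
        ω ∈ openConnIn {x : Site 3 | 0 ≤ x 0} 0 y} ≤ C * (r : ℝ) ^ (-a)) (m : ℕ) :
    1 - 576 * 2 ^ a * C * ((m + 2 : ℕ) : ℝ) ^ (-(a / 2)) ≤
      (bondPercolation (zdGraph 3) (criticalProbI 3)).real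
        {ω | ∃ S : Finset (Sym2 (Site 3)), (S.card : ℝ) ≤ ((m + 2 : ℕ) : ℝ) ^ (2 - a / 2) ∧
          ¬ ∃ x ∈ box 3 (m + 2), ∃ y ∈ innerBoundary (zdGraph 3) (box 3 (2 * m + 3 + 1)),
            (ω \ ↑S) ∈ openConnIn (↑(box 3 (2 * m + 3 + 1)) : Set (Site 3)) x y} := by
  set t : ℝ := ((m + 2 : ℕ) : ℝ) with ht
  have ht2 : (2 : ℝ) ≤ t := by rw [ht]; exact_mod_cast (by omega : 2 ≤ m + 2)
  have ht0 : 0 < t := by linarith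
  have hb0 : 0 < t ^ (2 - a / 2) := Real.rpow_pos_of_pos ht0 _
  -- Step A: off the budget event the counting variable is large (the random cutset)
  have hA : (bondPercolation (zdGraph 3) (criticalProbI 3)).real
      {ω | ∃ S : Finset (Sym2 (Site 3)), (S.card : ℝ) ≤ t ^ (2 - a / 2) ∧
        ¬ ∃ x ∈ box 3 (m + 2), ∃ y ∈ innerBoundary (zdGraph 3) (box 3 (2 * m + 3 + 1)),
          (ω \ ↑S) ∈ openConnIn (↑(box 3 (2 * m + 3 + 1)) : Set (Site 3)) x y}ᶜ ≤
      (bondPercolation (zdGraph 3) (criticalProbI 3)).real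
      {ω | t ^ (2 - a / 2) / 6 ≤ ∑ u ∈ innerBoundary (zdGraph 3) (box 3 (2 * m + 3)),
        (⋃ x ∈ box 3 (m + 2), openConnIn (↑(box 3 (2 * m + 3)) : Set (Site 3)) u x).indicator
          (1 : BondConfig (Site 3) → ℝ) ω} := by
    refine DCT16.real_mono_of_forall_subset_edgeSet (zdGraph 3) _ fun ω hω hωE => ?_
    rw [Set.mem_compl_iff, Set.mem_setOf_eq] at hωE
    rw [Set.mem_setOf_eq]
    by_contra hlt
    push Not at hlt
    obtain ⟨S, hS, hcut⟩ := exists_cutset_card_le (n := m + 2) (k := 2 * m + 3) (by omega) hω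
    exact hωE ⟨S, by linarith, hcut⟩
  -- Step B: Markov
  have hB : (bondPercolation (zdGraph 3) (criticalProbI 3)).real
      {ω | t ^ (2 - a / 2) / 6 ≤ ∑ u ∈ innerBoundary (zdGraph 3) (box 3 (2 * m + 3)),
        (⋃ x ∈ box 3 (m + 2), openConnIn (↑(box 3 (2 * m + 3)) : Set (Site 3)) u x).indicator
          (1 : BondConfig (Site 3) → ℝ) ω} ≤
      (∑ u ∈ innerBoundary (zdGraph 3) (box 3 (2 * m + 3)),
        (bondPercolation (zdGraph 3) (criticalProbI 3)).real
          (⋃ x ∈ box 3 (m + 2), openConnIn (↑(box 3 (2 * m + 3)) : Set (Site 3)) u x)) /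
        (t ^ (2 - a / 2) / 6) :=
    measureReal_setOf_le_sum_indicator_le _ _ _
      (fun u _ => measurableSet_iUnion_openConnIn_box (m + 2) (2 * m + 3) u) (by positivity)
  -- Step C: each arm probability is at most `C (m+1)^{-a} ≤ C 2^a t^{-a}`
  have hpow : ((m + 1 : ℕ) : ℝ) ^ (-a) ≤ 2 ^ a * t ^ (-a) := by
    have h1 : t / 2 ≤ ((m + 1 : ℕ) : ℝ) := by rw [ht]; push_cast; linarith
    calc ((m + 1 : ℕ) : ℝ) ^ (-a) ≤ (t / 2) ^ (-a) :=
          Real.rpow_le_rpow_of_nonpos (by positivity) h1 (by linarith)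
      _ = 2 ^ a * t ^ (-a) := by
          rw [Real.div_rpow ht0.le zero_le_two, Real.rpow_neg zero_le_two, div_inv_eq_mul,
            mul_comm]
  have hC' : ∀ u ∈ innerBoundary (zdGraph 3) (box 3 (2 * m + 3)),
      (bondPercolation (zdGraph 3) (criticalProbI 3)).real
          (⋃ x ∈ box 3 (m + 2), openConnIn (↑(box 3 (2 * m + 3)) : Set (Site 3)) u x) ≤
        C * (2 ^ a * t ^ (-a)) := by
    intro u hu
    have hr : ((m + 1 : ℕ) : ℤ) ≤ ((2 * m + 3 : ℕ) : ℤ) - ((m + 2 : ℕ) : ℤ) := by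
      push_cast; linarith
    refine (real_arm_le hr hu _).trans (((hH (m + 1) (by omega)).trans ?_))
    exact mul_le_mul_of_nonneg_left hpow hC
  -- Step D: the size of `∂B(2m+3)`
  have hD : ((innerBoundary (zdGraph 3) (box 3 (2 * m + 3))).card : ℝ) ≤ 96 * t ^ 2 := by
    have h1 := card_innerBoundary_box_le (d := 3) (2 * m + 3)
    have h2 : 2 * 3 * (2 * (2 * m + 3) + 1) ^ (3 - 1) = 6 * (4 * m + 7) ^ 2 := by norm_num; ring
    rw [h2] at h1
    have h3 : ((innerBoundary (zdGraph 3) (box 3 (2 * m + 3))).card : ℝ) ≤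
        6 * ((4 * m + 7 : ℕ) : ℝ) ^ 2 := by exact_mod_cast h1
    have h4 : ((4 * m + 7 : ℕ) : ℝ) ≤ 4 * t := by rw [ht]; push_cast; linarith
    have h5 : ((4 * m + 7 : ℕ) : ℝ) ^ 2 ≤ (4 * t) ^ 2 := pow_le_pow_left₀ (Nat.cast_nonneg _) h4 2
    nlinarith [h3, h5]
  -- Step E: the first moment
  have hE : ∑ u ∈ innerBoundary (zdGraph 3) (box 3 (2 * m + 3)),
      (bondPercolation (zdGraph 3) (criticalProbI 3)).real
        (⋃ x ∈ box 3 (m + 2), openConnIn (↑(box 3 (2 * m + 3)) : Set (Site 3)) u x) ≤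
      96 * 2 ^ a * C * t ^ (2 - a) := by
    calc ∑ u ∈ innerBoundary (zdGraph 3) (box 3 (2 * m + 3)),
          (bondPercolation (zdGraph 3) (criticalProbI 3)).real
            (⋃ x ∈ box 3 (m + 2), openConnIn (↑(box 3 (2 * m + 3)) : Set (Site 3)) u x)
        ≤ ∑ _u ∈ innerBoundary (zdGraph 3) (box 3 (2 * m + 3)), C * (2 ^ a * t ^ (-a)) :=
          Finset.sum_le_sum hC'
      _ = ((innerBoundary (zdGraph 3) (box 3 (2 * m + 3))).card : ℝ) * (C * (2 ^ a * t ^ (-a))) :=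
          by rw [Finset.sum_const, nsmul_eq_mul]
      _ ≤ (96 * t ^ 2) * (C * (2 ^ a * t ^ (-a))) :=
          mul_le_mul_of_nonneg_right hD (mul_nonneg hC (by positivity))
      _ = 96 * 2 ^ a * C * (t ^ (2 : ℝ) * t ^ (-a)) := by rw [Real.rpow_two]; ring
      _ = 96 * 2 ^ a * C * t ^ (2 - a) := by rw [← Real.rpow_add ht0]; ring_nf
  -- Step F: assemble
  have hEc : (bondPercolation (zdGraph 3) (criticalProbI 3)).real
      {ω | ∃ S : Finset (Sym2 (Site 3)), (S.card : ℝ) ≤ t ^ (2 - a / 2) ∧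
        ¬ ∃ x ∈ box 3 (m + 2), ∃ y ∈ innerBoundary (zdGraph 3) (box 3 (2 * m + 3 + 1)),
          (ω \ ↑S) ∈ openConnIn (↑(box 3 (2 * m + 3 + 1)) : Set (Site 3)) x y}ᶜ ≤
      576 * 2 ^ a * C * t ^ (-(a / 2)) := by
    refine (hA.trans hB).trans ((div_le_div_of_nonneg_right hE (by positivity)).trans_eq ?_)
    have h1 : t ^ (2 - a) = t ^ (-(a / 2)) * t ^ (2 - a / 2) := by
      rw [← Real.rpow_add ht0]; ring_nf
    rw [h1]
    field_simp
    ring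
  have hF := measureReal_union_le (μ := bondPercolation (zdGraph 3) (criticalProbI 3))
    {ω | ∃ S : Finset (Sym2 (Site 3)), (S.card : ℝ) ≤ t ^ (2 - a / 2) ∧
        ¬ ∃ x ∈ box 3 (m + 2), ∃ y ∈ innerBoundary (zdGraph 3) (box 3 (2 * m + 3 + 1)),
          (ω \ ↑S) ∈ openConnIn (↑(box 3 (2 * m + 3 + 1)) : Set (Site 3)) x y}
    {ω | ∃ S : Finset (Sym2 (Site 3)), (S.card : ℝ) ≤ t ^ (2 - a / 2) ∧
        ¬ ∃ x ∈ box 3 (m + 2), ∃ y ∈ innerBoundary (zdGraph 3) (box 3 (2 * m + 3 + 1)),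
          (ω \ ↑S) ∈ openConnIn (↑(box 3 (2 * m + 3 + 1)) : Set (Site 3)) x y}ᶜ
  rw [Set.union_compl_self, probReal_univ] at hF
  linarith

/-- **`DefectDimensionOfQuantBGN`** (item `stmt-CriticalPhenomena-5252` of route
`PercBudgetLadder`, exact signature): a polynomial rate
`P_{p_c}(C_ℍ(0) reaches sup-distance r) ≤ C r^{-a}` in the Barsky–Grimmett–Newman theorem implies
defect dimension `< 2` with saving `c = a/2`:
`P_{p_c}(∃ S, #S ≤ n^{2-a/2}, closing S blocks B(n) → ∂B(2n) inside B(2n)) → 1`.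
Squeeze between `real_budgetEvent_ge` (at `n = m + 2`) and `1`.
(Rossignol–Théret 2018, Prop. 3.9; Zhang 2000.) [cite: RossignolTheret2018, Prop. 3.9] -/
theorem defectDimensionOfQuantBGN_proof :
    Summit.CriticalPhenomena.PercolationContinuityZ3.Theses.PercBudgetLadder.DefectDimensionOfQuantBGN := by
  rintro ⟨a, C, ha, hH⟩
  refine ⟨a / 2, by positivity, ?_⟩
  -- `C ≥ 0` (the hypothesis at `r = 1`)
  have hC : 0 ≤ C := by
    have h := hH 1 le_rfl
    simp only [Nat.cast_one, Real.one_rpow, mul_one] at h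
    exact measureReal_nonneg.trans h
  -- the error term tends to `0`
  have herr : Tendsto (fun n : ℕ => 576 * 2 ^ a * C * (n : ℝ) ^ (-(a / 2))) atTop (𝓝 0) := by
    have h1 : Tendsto (fun n : ℕ => (n : ℝ) ^ (-(a / 2))) atTop (𝓝 0) :=
      (tendsto_rpow_neg_atTop (by positivity)).comp tendsto_natCast_atTop_atTop
    simpa using h1.const_mul (576 * 2 ^ a * C)
  have hlow : Tendsto (fun n : ℕ => 1 - 576 * 2 ^ a * C * (n : ℝ) ^ (-(a / 2))) atTop (𝓝 1) := by
    simpa using (tendsto_const_nhds (x := (1 : ℝ))).sub herr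
  refine tendsto_of_tendsto_of_tendsto_of_le_of_le' hlow tendsto_const_nhds ?_
    (Eventually.of_forall fun n => measureReal_le_one)
  filter_upwards [eventually_ge_atTop 2] with n hn
  obtain ⟨m, rfl⟩ : ∃ m, n = m + 2 := ⟨n - 2, by omega⟩
  have hk : 2 * (m + 2) = 2 * m + 3 + 1 := by ring
  rw [hk]
  exact real_budgetEvent_ge ha hC hH m

end

end Summit.CriticalPhenomena.PercolationContinuityZ3.Theorems
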